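import Summits.CriticalPhenomena.PercolationContinuityZ3.Theorems.PercNearOneGluingNoHeavyLowerTailThreePartitionTwistedCone

/-!
# `NoHeavyLowerTail` (crux stmt-CriticalPhenomena-4575): the TWISTED CONE STEP along a coordinate INSIDE the twist ('digit 2'):
# `2·N_{τ'}(𝒰ᵉ,𝒱ᵉ,𝒲ᵉ) ≤ 3·N_{insert e τ'}(𝒰,𝒱,𝒲)` when every member of `𝒰` contains `e` (`e ∉ τ'`)

Support file (lane `prim-ineq-gen-4`, generation 15; `--supports stmt-CriticalPhenomena-4575`).  Pure proofs, no definitions, no `sorry`, standard axioms.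
With `τ = insert e τ'`, `e ∉ τ'`, the `τ`-copies are `S_a ∆ τ = (S_a ∆ τ') ∆ {e}`: the copy whose part holds `e` reads the BOTTOM section `{T | T ∖ e ∈ 𝒵}` and the
other two read the top section `{T | insert e T ∈ 𝒵}` (`twist_insert_eq_of_mem/_of_notMem`).  Splitting every count by the position of `e` (`tri_split`), moving `e`
into the free part (`tri_move12/32`) and using that `𝒰` has empty bottom section, `3·N_τ(𝒰) − 2·N_{τ'}(𝒰ᵉ) = 3·[g₁ + (g₂ − X) + (g₃ − Y)]` with the SAME increment bounds
`X ≤ g₂`, `Y ≤ g₃` (two `teeT_le_deeT` steps) as the digit-1 step `…ThreePartitionTwistedCone` — this is the lane's Theorem C (`c₂ ≥ 2c₃` on the empty-bottom face, g13)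
in the `threePartNT` language.  Consequence (next file `…ThreePartitionTwistedPrincipal`): `0 ≤ threePartNT τ {T | S ⊆ T} 𝒱 𝒲` for EVERY twist `τ`, every `S`,
all up-sets `𝒱, 𝒲`.  HONEST LABEL: a face of `ThreePartitionPositivityTwisted`, not the conjecture.  Memo: `run/shared/lean/prim/prim-ineq-gen-4/FINDING-LEVEL2-CUBE-TPP-g15.md` §5(a). [this work]
-/

noncomputable section

open Finset
open scoped symmDiff Classical

namespace Summit.CriticalPhenomena.PercolationContinuityZ3.Theorems.ThreePartition

variable {ι : Type*} [Fintype ι]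

/-! ## Twisting by `insert e τ'` versus by `τ'` -/

omit [Fintype ι] in
/-- `e ∈ S`, `e ∉ τ'`: `S ∆ insert e τ' = (S ∆ τ') ∖ e`. [folklore] -/
theorem twist_insert_eq_of_mem {e : ι} {τ' S : Set ι} (heτ : e ∉ τ') (he : e ∈ S) : S ∆ insert e τ' = (S ∆ τ') \ {e} := by
  ext x
  simp only [Set.mem_symmDiff, Set.mem_insert_iff, Set.mem_sdiff, Set.mem_singleton_iff]
  by_cases hx : x = e
  · subst hx; tauto
  · tauto

omit [Fintype ι] in
/-- `e ∉ S`, `e ∉ τ'`: `S ∆ insert e τ' = insert e (S ∆ τ')`. [folklore] -/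
theorem twist_insert_eq_of_notMem {e : ι} {τ' S : Set ι} (heτ : e ∉ τ') (he : e ∉ S) : S ∆ insert e τ' = insert e (S ∆ τ') := by
  ext x
  simp only [Set.mem_symmDiff, Set.mem_insert_iff]
  by_cases hx : x = e
  · subst hx; tauto
  · tauto

/-- A count over an impossible predicate vanishes. [this work] -/
theorem tri_eq_zero {p : Set ι → Set ι → Set ι → Prop} (h : ∀ S₁ S₂ : Set ι, Disjoint S₁ S₂ → ¬ p S₁ S₂ (S₁ ∪ S₂)ᶜ) : tri p = 0 := by
  unfold tri
  rw [Finset.card_eq_zero, Finset.filter_eq_empty_iff]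
  intro q _ hq
  exact h _ _ hq.1 hq.2

/-- A predicate covered by two others: `tri r ≤ tri p + tri q`. [this work] -/
theorem tri_le_add₂ {p q r : Set ι → Set ι → Set ι → Prop}
    (h : ∀ S₁ S₂ S₃, r S₁ S₂ S₃ → p S₁ S₂ S₃ ∨ q S₁ S₂ S₃) : tri r ≤ tri p + tri q := by
  have h3 := tri_le_add₃ (p := p) (q := q) (s := fun _ _ _ => False) (r := r) (fun S₁ S₂ S₃ hr => by
    rcases h S₁ S₂ S₃ hr with h1 | h1
    · exact Or.inl h1
    · exact Or.inr (Or.inl h1))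
  have h0 : tri (fun (_ _ _ : Set ι) => False) = 0 := tri_eq_zero fun _ _ _ h => h
  omega

/-! ## The digit-2 blocks: counts twisted by `insert e τ'` as pinned `τ'`-counts -/

section DigitTwo

variable (τ' : Set ι) (e : ι) {𝒰 𝒱 𝒲 : Set (Set ι)}

/-- `topT (insert e τ') (𝒰∩𝒱∩𝒲)` is twice the pinned count (blocks `e ∈ S₁`, `e ∈ S₂`; the block `e ∈ S₃` is empty). [this work] -/
theorem topT_insert_eq_two_mul (heτ : e ∉ τ') (h𝒰e : ∀ T ∈ 𝒰, e ∈ T) :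
    topT (insert e τ') (𝒰 ∩ 𝒱 ∩ 𝒲) = 2 * tri (fun _ S₂ S₃ => e ∈ S₂ ∧ S₃ ∆ τ' ∈ {R : Set ι | insert e R ∈ 𝒰 ∩ 𝒱 ∩ 𝒲}) := by
  unfold topT triT
  rw [tri_split e]
  have h3 : tri (fun S₁ S₂ S₃ => e ∈ S₃ ∧ S₃ ∆ insert e τ' ∈ 𝒰 ∩ 𝒱 ∩ 𝒲) = 0 := by
    refine tri_eq_zero fun S₁ S₂ _ h => ?_
    have := h𝒰e _ h.2.1.1
    rw [twist_insert_eq_of_mem heτ h.1] at this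
    exact this.2 rfl
  have h1 : tri (fun S₁ S₂ S₃ => e ∈ S₁ ∧ S₃ ∆ insert e τ' ∈ 𝒰 ∩ 𝒱 ∩ 𝒲)
      = tri (fun _ S₂ S₃ => e ∈ S₂ ∧ S₃ ∆ τ' ∈ {R : Set ι | insert e R ∈ 𝒰 ∩ 𝒱 ∩ 𝒲}) := by
    rw [show tri (fun S₁ S₂ S₃ => e ∈ S₁ ∧ S₃ ∆ insert e τ' ∈ 𝒰 ∩ 𝒱 ∩ 𝒲)
        = tri (fun S₁ S₂ S₃ => e ∈ S₁ ∧ (fun (_ _ S₃ : Set ι) => S₃ ∆ τ' ∈ {R : Set ι | insert e R ∈ 𝒰 ∩ 𝒱 ∩ 𝒲}) S₁ S₂ S₃) from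
      tri_congr fun S₁ S₂ hd => by
        constructor
        · rintro ⟨he, h⟩
          have he3 : e ∉ (S₁ ∪ S₂)ᶜ := fun h' => h' (Or.inl he)
          rw [twist_insert_eq_of_notMem heτ he3] at h; exact ⟨he, h⟩
        · rintro ⟨he, h⟩
          have he3 : e ∉ (S₁ ∪ S₂)ᶜ := fun h' => h' (Or.inl he)
          refine ⟨he, ?_⟩; rw [twist_insert_eq_of_notMem heτ he3]; exact h]
    rw [tri_move12]
  have h2 : tri (fun S₁ S₂ S₃ => e ∈ S₂ ∧ S₃ ∆ insert e τ' ∈ 𝒰 ∩ 𝒱 ∩ 𝒲)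
      = tri (fun _ S₂ S₃ => e ∈ S₂ ∧ S₃ ∆ τ' ∈ {R : Set ι | insert e R ∈ 𝒰 ∩ 𝒱 ∩ 𝒲}) := by
    refine tri_congr fun S₁ S₂ hd => ?_
    constructor
    · rintro ⟨he, h⟩
      have he3 : e ∉ (S₁ ∪ S₂)ᶜ := fun h' => h' (Or.inr he)
      rw [twist_insert_eq_of_notMem heτ he3] at h; exact ⟨he, h⟩
    · rintro ⟨he, h⟩
      have he3 : e ∉ (S₁ ∪ S₂)ᶜ := fun h' => h' (Or.inr he)
      refine ⟨he, ?_⟩; rw [twist_insert_eq_of_notMem heτ he3]; exact h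
  rw [h1, h2, h3]
  ring

/-- `teeT (insert e τ') 𝒰 𝒱 𝒲 = tB + tC` (blocks `e ∈ S₂`: part 2 read in the bottom section of `𝒱`; `e ∈ S₃`: part 3 in the bottom section of `𝒲`). [this work] -/
theorem teeT_insert_eq (heτ : e ∉ τ') (h𝒰e : ∀ T ∈ 𝒰, e ∈ T) :
    teeT (insert e τ') 𝒰 𝒱 𝒲
      = tri (fun S₁ S₂ S₃ => e ∈ S₂ ∧ (S₁ ∆ τ' ∈ {R : Set ι | insert e R ∈ 𝒰} ∧ (S₂ ∆ τ') \ {e} ∈ 𝒱 ∧ S₃ ∆ τ' ∈ {R : Set ι | insert e R ∈ 𝒲}))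
        + tri (fun S₁ S₂ S₃ => e ∈ S₂ ∧ (S₁ ∆ τ' ∈ {R : Set ι | insert e R ∈ 𝒰} ∧ S₂ ∆ τ' ∈ 𝒱 ∧ S₃ ∆ τ' ∈ 𝒲)) := by
  unfold teeT triT
  rw [tri_split e]
  have h1 : tri (fun S₁ S₂ S₃ => e ∈ S₁ ∧ (S₁ ∆ insert e τ' ∈ 𝒰 ∧ S₂ ∆ insert e τ' ∈ 𝒱 ∧ S₃ ∆ insert e τ' ∈ 𝒲)) = 0 := by
    refine tri_eq_zero fun S₁ S₂ _ h => ?_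
    have := h𝒰e _ h.2.1
    rw [twist_insert_eq_of_mem heτ h.1] at this
    exact this.2 rfl
  have h2 : tri (fun S₁ S₂ S₃ => e ∈ S₂ ∧ (S₁ ∆ insert e τ' ∈ 𝒰 ∧ S₂ ∆ insert e τ' ∈ 𝒱 ∧ S₃ ∆ insert e τ' ∈ 𝒲))
      = tri (fun S₁ S₂ S₃ => e ∈ S₂ ∧ (S₁ ∆ τ' ∈ {R : Set ι | insert e R ∈ 𝒰} ∧ (S₂ ∆ τ') \ {e} ∈ 𝒱 ∧ S₃ ∆ τ' ∈ {R : Set ι | insert e R ∈ 𝒲})) := by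
    refine tri_congr fun S₁ S₂ hd => ?_
    have key : e ∈ S₂ → (e ∉ S₁ ∧ e ∉ (S₁ ∪ S₂)ᶜ) := fun he => ⟨fun h => Set.disjoint_left.1 hd h he, fun h => h (Or.inr he)⟩
    constructor
    · rintro ⟨he, hU, hV, hW⟩
      obtain ⟨he1, he3⟩ := key he
      rw [twist_insert_eq_of_notMem heτ he1] at hU
      rw [twist_insert_eq_of_mem heτ he] at hV
      rw [twist_insert_eq_of_notMem heτ he3] at hW
      exact ⟨he, hU, hV, hW⟩
    · rintro ⟨he, hU, hV, hW⟩
      obtain ⟨he1, he3⟩ := key he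
      refine ⟨he, ?_, ?_, ?_⟩
      · rw [twist_insert_eq_of_notMem heτ he1]; exact hU
      · rw [twist_insert_eq_of_mem heτ he]; exact hV
      · rw [twist_insert_eq_of_notMem heτ he3]; exact hW
  have h3 : tri (fun S₁ S₂ S₃ => e ∈ S₃ ∧ (S₁ ∆ insert e τ' ∈ 𝒰 ∧ S₂ ∆ insert e τ' ∈ 𝒱 ∧ S₃ ∆ insert e τ' ∈ 𝒲))
      = tri (fun S₁ S₂ S₃ => e ∈ S₂ ∧ (S₁ ∆ τ' ∈ {R : Set ι | insert e R ∈ 𝒰} ∧ S₂ ∆ τ' ∈ 𝒱 ∧ S₃ ∆ τ' ∈ 𝒲)) := by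
    rw [show tri (fun S₁ S₂ S₃ => e ∈ S₃ ∧ (S₁ ∆ insert e τ' ∈ 𝒰 ∧ S₂ ∆ insert e τ' ∈ 𝒱 ∧ S₃ ∆ insert e τ' ∈ 𝒲))
        = tri (fun S₁ S₂ S₃ => e ∈ S₃ ∧ (fun (S₁ S₂ S₃ : Set ι) => S₁ ∆ τ' ∈ {R : Set ι | insert e R ∈ 𝒰} ∧ S₂ ∆ τ' ∈ {R : Set ι | insert e R ∈ 𝒱} ∧ (S₃ ∆ τ') \ {e} ∈ 𝒲) S₁ S₂ S₃) from
      tri_congr fun S₁ S₂ hd => by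
        constructor
        · rintro ⟨he, hU, hV, hW⟩
          have he1 : e ∉ S₁ := fun h => he (Or.inl h)
          have he2 : e ∉ S₂ := fun h => he (Or.inr h)
          rw [twist_insert_eq_of_notMem heτ he1] at hU
          rw [twist_insert_eq_of_notMem heτ he2] at hV
          rw [twist_insert_eq_of_mem heτ he] at hW
          exact ⟨he, hU, hV, hW⟩
        · rintro ⟨he, hU, hV, hW⟩
          have he1 : e ∉ S₁ := fun h => he (Or.inl h)
          have he2 : e ∉ S₂ := fun h => he (Or.inr h)
          refine ⟨he, ?_, ?_, ?_⟩
          · rw [twist_insert_eq_of_notMem heτ he1]; exact hU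
          · rw [twist_insert_eq_of_notMem heτ he2]; exact hV
          · rw [twist_insert_eq_of_mem heτ he]; exact hW]
    rw [tri_move32]
    refine tri_congr fun S₁ S₂ hd => ?_
    have eq2 : (S₂ \ {e}) ∆ τ' = (S₂ ∆ τ') \ {e} := sdiff_symmDiff_of_notMem heτ _
    have eq3 : insert e (S₁ ∪ S₂)ᶜ ∆ τ' = insert e ((S₁ ∪ S₂)ᶜ ∆ τ') := insert_symmDiff_of_notMem heτ _
    constructor
    · rintro ⟨he, hU, hV, hW⟩
      have he3 : e ∉ (S₁ ∪ S₂)ᶜ ∆ τ' := fun h => ((mem_symmDiff_iff_of_notMem heτ _).1 h) (Or.inr he)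
      rw [eq2, diff_mem_liftAt_iff, mem_liftAt_iff_of_mem 𝒱 ((mem_symmDiff_iff_of_notMem heτ _).2 he)] at hV
      rw [eq3, insert_sdiff_singleton_of_notMem he3] at hW
      exact ⟨he, hU, hV, hW⟩
    · rintro ⟨he, hU, hV, hW⟩
      have he3 : e ∉ (S₁ ∪ S₂)ᶜ ∆ τ' := fun h => ((mem_symmDiff_iff_of_notMem heτ _).1 h) (Or.inr he)
      refine ⟨he, hU, ?_, ?_⟩
      · rw [eq2, diff_mem_liftAt_iff, mem_liftAt_iff_of_mem 𝒱 ((mem_symmDiff_iff_of_notMem heτ _).2 he)]; exact hV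
      · rw [eq3, insert_sdiff_singleton_of_notMem he3]; exact hW
  rw [h1, h2, h3]
  ring

/-- `deeT (insert e τ') 𝒰 (𝒱∩𝒲) = d₁ᵉ-part + bottom part` (blocks `e ∈ S₂`, `e ∈ S₃`). [this work] -/
theorem deeT_one_insert_eq (heτ : e ∉ τ') (h𝒰e : ∀ T ∈ 𝒰, e ∈ T) :
    deeT (insert e τ') 𝒰 (𝒱 ∩ 𝒲)
      = tri (fun S₁ S₂ S₃ => e ∈ S₂ ∧ (S₁ ∆ τ' ∈ {R : Set ι | insert e R ∈ 𝒰} ∧ S₃ ∆ τ' ∈ {R : Set ι | insert e R ∈ 𝒱} ∩ {R : Set ι | insert e R ∈ 𝒲}))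
        + tri (fun S₁ S₂ S₃ => e ∈ S₂ ∧ (S₁ ∆ τ' ∈ {R : Set ι | insert e R ∈ 𝒰} ∧ S₃ ∆ τ' ∈ 𝒱 ∩ 𝒲)) := by
  unfold deeT triT
  rw [tri_split e]
  have h1 : tri (fun S₁ S₂ S₃ => e ∈ S₁ ∧ (S₁ ∆ insert e τ' ∈ 𝒰 ∧ S₃ ∆ insert e τ' ∈ 𝒱 ∩ 𝒲)) = 0 := by
    refine tri_eq_zero fun S₁ S₂ _ h => ?_
    have := h𝒰e _ h.2.1
    rw [twist_insert_eq_of_mem heτ h.1] at this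
    exact this.2 rfl
  have h2 : tri (fun S₁ S₂ S₃ => e ∈ S₂ ∧ (S₁ ∆ insert e τ' ∈ 𝒰 ∧ S₃ ∆ insert e τ' ∈ 𝒱 ∩ 𝒲))
      = tri (fun S₁ S₂ S₃ => e ∈ S₂ ∧ (S₁ ∆ τ' ∈ {R : Set ι | insert e R ∈ 𝒰} ∧ S₃ ∆ τ' ∈ {R : Set ι | insert e R ∈ 𝒱} ∩ {R : Set ι | insert e R ∈ 𝒲})) := by
    refine tri_congr fun S₁ S₂ hd => ?_
    have key : e ∈ S₂ → (e ∉ S₁ ∧ e ∉ (S₁ ∪ S₂)ᶜ) := fun he => ⟨fun h => Set.disjoint_left.1 hd h he, fun h => h (Or.inr he)⟩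
    constructor
    · rintro ⟨he, hU, hW⟩
      obtain ⟨he1, he3⟩ := key he
      rw [twist_insert_eq_of_notMem heτ he1] at hU
      rw [twist_insert_eq_of_notMem heτ he3] at hW
      exact ⟨he, hU, hW⟩
    · rintro ⟨he, hU, hW⟩
      obtain ⟨he1, he3⟩ := key he
      refine ⟨he, ?_, ?_⟩
      · rw [twist_insert_eq_of_notMem heτ he1]; exact hU
      · rw [twist_insert_eq_of_notMem heτ he3]; exact hW
  have h3 : tri (fun S₁ S₂ S₃ => e ∈ S₃ ∧ (S₁ ∆ insert e τ' ∈ 𝒰 ∧ S₃ ∆ insert e τ' ∈ 𝒱 ∩ 𝒲))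
      = tri (fun S₁ S₂ S₃ => e ∈ S₂ ∧ (S₁ ∆ τ' ∈ {R : Set ι | insert e R ∈ 𝒰} ∧ S₃ ∆ τ' ∈ 𝒱 ∩ 𝒲)) := by
    rw [show tri (fun S₁ S₂ S₃ => e ∈ S₃ ∧ (S₁ ∆ insert e τ' ∈ 𝒰 ∧ S₃ ∆ insert e τ' ∈ 𝒱 ∩ 𝒲))
        = tri (fun S₁ S₂ S₃ => e ∈ S₃ ∧ (fun (S₁ _ S₃ : Set ι) => S₁ ∆ τ' ∈ {R : Set ι | insert e R ∈ 𝒰} ∧ (S₃ ∆ τ') \ {e} ∈ 𝒱 ∩ 𝒲) S₁ S₂ S₃) from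
      tri_congr fun S₁ S₂ hd => by
        constructor
        · rintro ⟨he, hU, hW⟩
          have he1 : e ∉ S₁ := fun h => he (Or.inl h)
          rw [twist_insert_eq_of_notMem heτ he1] at hU
          rw [twist_insert_eq_of_mem heτ he] at hW
          exact ⟨he, hU, hW⟩
        · rintro ⟨he, hU, hW⟩
          have he1 : e ∉ S₁ := fun h => he (Or.inl h)
          refine ⟨he, ?_, ?_⟩
          · rw [twist_insert_eq_of_notMem heτ he1]; exact hU
          · rw [twist_insert_eq_of_mem heτ he]; exact hW]
    rw [tri_move32]
    refine tri_congr fun S₁ S₂ hd => ?_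
    have eq3 : insert e (S₁ ∪ S₂)ᶜ ∆ τ' = insert e ((S₁ ∪ S₂)ᶜ ∆ τ') := insert_symmDiff_of_notMem heτ _
    constructor
    · rintro ⟨he, hU, hW⟩
      have he3 : e ∉ (S₁ ∪ S₂)ᶜ ∆ τ' := fun h => ((mem_symmDiff_iff_of_notMem heτ _).1 h) (Or.inr he)
      rw [eq3, insert_sdiff_singleton_of_notMem he3] at hW
      exact ⟨he, hU, hW⟩
    · rintro ⟨he, hU, hW⟩
      have he3 : e ∉ (S₁ ∪ S₂)ᶜ ∆ τ' := fun h => ((mem_symmDiff_iff_of_notMem heτ _).1 h) (Or.inr he)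
      refine ⟨he, hU, ?_⟩
      rw [eq3, insert_sdiff_singleton_of_notMem he3]; exact hW
  rw [h1, h2, h3]
  ring

/-- `deeT (insert e τ') 𝒱 (𝒰∩𝒲) = d₂ᵉ + bottom part` (blocks `e ∈ S₂`, `e ∈ S₁`). [this work] -/
theorem deeT_two_insert_eq (heτ : e ∉ τ') (h𝒰e : ∀ T ∈ 𝒰, e ∈ T) :
    deeT (insert e τ') 𝒱 (𝒰 ∩ 𝒲)
      = tri (fun S₁ S₂ S₃ => e ∈ S₂ ∧ (S₁ ∆ τ' ∈ {R : Set ι | insert e R ∈ 𝒱} ∧ S₃ ∆ τ' ∈ {R : Set ι | insert e R ∈ 𝒰} ∩ {R : Set ι | insert e R ∈ 𝒲}))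
        + tri (fun S₁ S₂ S₃ => e ∈ S₂ ∧ (S₁ ∆ τ' ∈ 𝒱 ∧ S₃ ∆ τ' ∈ {R : Set ι | insert e R ∈ 𝒰 ∩ 𝒲})) := by
  unfold deeT triT
  rw [tri_split e]
  have h3 : tri (fun S₁ S₂ S₃ => e ∈ S₃ ∧ (S₁ ∆ insert e τ' ∈ 𝒱 ∧ S₃ ∆ insert e τ' ∈ 𝒰 ∩ 𝒲)) = 0 := by
    refine tri_eq_zero fun S₁ S₂ _ h => ?_
    have := h𝒰e _ h.2.2.1
    rw [twist_insert_eq_of_mem heτ h.1] at this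
    exact this.2 rfl
  have h2 : tri (fun S₁ S₂ S₃ => e ∈ S₂ ∧ (S₁ ∆ insert e τ' ∈ 𝒱 ∧ S₃ ∆ insert e τ' ∈ 𝒰 ∩ 𝒲))
      = tri (fun S₁ S₂ S₃ => e ∈ S₂ ∧ (S₁ ∆ τ' ∈ {R : Set ι | insert e R ∈ 𝒱} ∧ S₃ ∆ τ' ∈ {R : Set ι | insert e R ∈ 𝒰} ∩ {R : Set ι | insert e R ∈ 𝒲})) := by
    refine tri_congr fun S₁ S₂ hd => ?_
    have key : e ∈ S₂ → (e ∉ S₁ ∧ e ∉ (S₁ ∪ S₂)ᶜ) := fun he => ⟨fun h => Set.disjoint_left.1 hd h he, fun h => h (Or.inr he)⟩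
    constructor
    · rintro ⟨he, hV, hW⟩
      obtain ⟨he1, he3⟩ := key he
      rw [twist_insert_eq_of_notMem heτ he1] at hV
      rw [twist_insert_eq_of_notMem heτ he3] at hW
      exact ⟨he, hV, hW⟩
    · rintro ⟨he, hV, hW⟩
      obtain ⟨he1, he3⟩ := key he
      refine ⟨he, ?_, ?_⟩
      · rw [twist_insert_eq_of_notMem heτ he1]; exact hV
      · rw [twist_insert_eq_of_notMem heτ he3]; exact hW
  have h1 : tri (fun S₁ S₂ S₃ => e ∈ S₁ ∧ (S₁ ∆ insert e τ' ∈ 𝒱 ∧ S₃ ∆ insert e τ' ∈ 𝒰 ∩ 𝒲))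
      = tri (fun S₁ S₂ S₃ => e ∈ S₂ ∧ (S₁ ∆ τ' ∈ 𝒱 ∧ S₃ ∆ τ' ∈ {R : Set ι | insert e R ∈ 𝒰 ∩ 𝒲})) := by
    rw [show tri (fun S₁ S₂ S₃ => e ∈ S₁ ∧ (S₁ ∆ insert e τ' ∈ 𝒱 ∧ S₃ ∆ insert e τ' ∈ 𝒰 ∩ 𝒲))
        = tri (fun S₁ S₂ S₃ => e ∈ S₁ ∧ (fun (S₁ _ S₃ : Set ι) => (S₁ ∆ τ') \ {e} ∈ 𝒱 ∧ S₃ ∆ τ' ∈ {R : Set ι | insert e R ∈ 𝒰 ∩ 𝒲}) S₁ S₂ S₃) from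
      tri_congr fun S₁ S₂ hd => by
        constructor
        · rintro ⟨he, hV, hW⟩
          have he3 : e ∉ (S₁ ∪ S₂)ᶜ := fun h => h (Or.inl he)
          rw [twist_insert_eq_of_mem heτ he] at hV
          rw [twist_insert_eq_of_notMem heτ he3] at hW
          exact ⟨he, hV, hW⟩
        · rintro ⟨he, hV, hW⟩
          have he3 : e ∉ (S₁ ∪ S₂)ᶜ := fun h => h (Or.inl he)
          refine ⟨he, ?_, ?_⟩
          · rw [twist_insert_eq_of_mem heτ he]; exact hV
          · rw [twist_insert_eq_of_notMem heτ he3]; exact hW]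
    rw [tri_move12]
    refine tri_congr fun S₁ S₂ hd => ?_
    have aux : ∀ (he : e ∈ S₂), (insert e S₁ ∆ τ') \ {e} = S₁ ∆ τ' := by
      intro he
      have he1 : e ∉ S₁ := fun h => Set.disjoint_left.1 hd h he
      rw [insert_symmDiff_of_notMem heτ, insert_sdiff_singleton_of_notMem]
      exact fun h => he1 ((mem_symmDiff_iff_of_notMem heτ _).1 h)
    have eq2 : (S₂ \ {e}) ∆ τ' = (S₂ ∆ τ') \ {e} := sdiff_symmDiff_of_notMem heτ _
    constructor
    · rintro ⟨he, hV, hW⟩; rw [aux he] at hV; exact ⟨he, hV, hW⟩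
    · rintro ⟨he, hV, hW⟩; refine ⟨he, ?_, hW⟩; rw [aux he]; exact hV
  rw [h1, h2, h3]
  ring

/-- The third-slot increment pays for the digit-2 `Y` (variant of `incrT_three_le` with the weaker middle condition). [this work] -/
theorem incrT_three_le' (heτ : e ∉ τ') (h𝒰 : IsUpperSet 𝒰) (h𝒱 : IsUpperSet 𝒱) :
    tri (fun S₁ S₂ S₃ => e ∈ S₂ ∧ (S₁ ∆ τ' ∈ {R : Set ι | insert e R ∈ 𝒰} ∧ S₂ ∆ τ' ∈ 𝒱 ∧ (S₃ ∆ τ' ∈ {R : Set ι | insert e R ∈ 𝒲} ∧ S₃ ∆ τ' ∉ 𝒲)))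
      ≤ tri (fun S₁ S₂ S₃ => e ∈ S₂ ∧ ((S₁ ∆ τ' ∈ {R : Set ι | insert e R ∈ 𝒲} ∧ S₁ ∆ τ' ∉ 𝒲) ∧ S₃ ∆ τ' ∈ {R : Set ι | insert e R ∈ 𝒰} ∩ {R : Set ι | insert e R ∈ 𝒱})) := by
  set 𝒟 : Set (Set ι) := {T | e ∈ T ∧ (T \ {e} ∈ {R : Set ι | insert e R ∈ 𝒲} ∧ T \ {e} ∉ 𝒲)} with h𝒟
  have step0 : tri (fun S₁ S₂ S₃ => e ∈ S₂ ∧ (S₁ ∆ τ' ∈ {R : Set ι | insert e R ∈ 𝒰} ∧ S₂ ∆ τ' ∈ 𝒱 ∧ (S₃ ∆ τ' ∈ {R : Set ι | insert e R ∈ 𝒲} ∧ S₃ ∆ τ' ∉ 𝒲)))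
      = tri (fun S₁ S₂ S₃ => e ∈ S₃ ∧ (fun (S₁ S₂ S₃ : Set ι) => S₁ ∆ τ' ∈ {R : Set ι | insert e R ∈ 𝒰} ∧ S₂ ∆ τ' ∈ {R : Set ι | insert e R ∈ 𝒱} ∧ (S₃ ∆ τ' ∈ {R : Set ι | insert e R ∈ 𝒲} ∧ (S₃ ∆ τ') \ {e} ∉ 𝒲)) S₁ S₂ S₃) := by
    rw [tri_move32]
    refine tri_congr fun S₁ S₂ hd => ?_
    have eq2 : (S₂ \ {e}) ∆ τ' = (S₂ ∆ τ') \ {e} := sdiff_symmDiff_of_notMem heτ _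
    have eq3 : insert e (S₁ ∪ S₂)ᶜ ∆ τ' = insert e ((S₁ ∪ S₂)ᶜ ∆ τ') := insert_symmDiff_of_notMem heτ _
    constructor
    · rintro ⟨he, h1, h2, h3, h4⟩
      have he3 : e ∉ (S₁ ∪ S₂)ᶜ ∆ τ' := fun h => ((mem_symmDiff_iff_of_notMem heτ _).1 h) (Or.inr he)
      have he2 : e ∈ S₂ ∆ τ' := (mem_symmDiff_iff_of_notMem heτ _).2 he
      refine ⟨he, h1, ?_, ?_, ?_⟩
      · rw [eq2, diff_mem_liftAt_iff, mem_liftAt_iff_of_mem 𝒱 he2]; exact h2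
      · rw [eq3, insert_mem_liftAt_iff]; exact h3
      · rw [eq3, insert_sdiff_singleton_of_notMem he3]; exact h4
    · rintro ⟨he, h1, h2, h3, h4⟩
      have he3 : e ∉ (S₁ ∪ S₂)ᶜ ∆ τ' := fun h => ((mem_symmDiff_iff_of_notMem heτ _).1 h) (Or.inr he)
      have he2 : e ∈ S₂ ∆ τ' := (mem_symmDiff_iff_of_notMem heτ _).2 he
      refine ⟨he, h1, ?_, ?_, ?_⟩
      · rw [eq2, diff_mem_liftAt_iff, mem_liftAt_iff_of_mem 𝒱 he2] at h2; exact h2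
      · rw [eq3, insert_mem_liftAt_iff] at h3; exact h3
      · rw [eq3, insert_sdiff_singleton_of_notMem he3] at h4; exact h4
  have step1 : tri (fun S₁ S₂ S₃ => e ∈ S₃ ∧ (fun (S₁ S₂ S₃ : Set ι) => S₁ ∆ τ' ∈ {R : Set ι | insert e R ∈ 𝒰} ∧ S₂ ∆ τ' ∈ {R : Set ι | insert e R ∈ 𝒱} ∧ (S₃ ∆ τ' ∈ {R : Set ι | insert e R ∈ 𝒲} ∧ (S₃ ∆ τ') \ {e} ∉ 𝒲)) S₁ S₂ S₃)
      ≤ teeT τ' ({R : Set ι | insert e R ∈ 𝒰}) ({R : Set ι | insert e R ∈ 𝒱}) 𝒟 := by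
    unfold teeT triT
    refine tri_mono fun S₁ S₂ _ h => ⟨h.2.1, h.2.2.1, ⟨(mem_symmDiff_iff_of_notMem heτ _).2 h.1, ?_, h.2.2.2.2⟩⟩
    rw [diff_mem_liftAt_iff]; exact h.2.2.2.1
  have step2 : teeT τ' ({R : Set ι | insert e R ∈ 𝒰}) ({R : Set ι | insert e R ∈ 𝒱}) 𝒟 = teeT τ' 𝒟 ({R : Set ι | insert e R ∈ 𝒱}) ({R : Set ι | insert e R ∈ 𝒰}) :=
    teeT_swap13 τ' _ _ _
  have step3 : teeT τ' 𝒟 ({R : Set ι | insert e R ∈ 𝒱}) ({R : Set ι | insert e R ∈ 𝒰}) ≤ deeT τ' 𝒟 ({R : Set ι | insert e R ∈ 𝒱} ∩ {R : Set ι | insert e R ∈ 𝒰}) :=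
    teeT_le_deeT τ' 𝒟 (isUpperSet_liftAt e h𝒱) (isUpperSet_liftAt e h𝒰)
  have step4 : deeT τ' 𝒟 ({R : Set ι | insert e R ∈ 𝒱} ∩ {R : Set ι | insert e R ∈ 𝒰})
      = tri (fun S₁ S₂ S₃ => e ∈ S₂ ∧ ((S₁ ∆ τ' ∈ {R : Set ι | insert e R ∈ 𝒲} ∧ S₁ ∆ τ' ∉ 𝒲) ∧ S₃ ∆ τ' ∈ {R : Set ι | insert e R ∈ 𝒰} ∩ {R : Set ι | insert e R ∈ 𝒱})) := by
    unfold deeT triT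
    rw [show tri (fun S₁ _ S₃ => S₁ ∆ τ' ∈ 𝒟 ∧ S₃ ∆ τ' ∈ {R : Set ι | insert e R ∈ 𝒱} ∩ {R : Set ι | insert e R ∈ 𝒰})
        = tri (fun S₁ S₂ S₃ => e ∈ S₁ ∧ (fun (S₁ _ S₃ : Set ι) => ((S₁ ∆ τ') \ {e} ∈ {R : Set ι | insert e R ∈ 𝒲} ∧ (S₁ ∆ τ') \ {e} ∉ 𝒲) ∧ S₃ ∆ τ' ∈ {R : Set ι | insert e R ∈ 𝒰} ∩ {R : Set ι | insert e R ∈ 𝒱}) S₁ S₂ S₃) from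
      tri_congr fun S₁ S₂ _ => by
        rw [h𝒟, Set.inter_comm]; simp only [Set.mem_setOf_eq, mem_symmDiff_iff_of_notMem heτ]; tauto]
    rw [tri_move12]
    refine tri_congr fun S₁ S₂ hd => ?_
    have aux : ∀ (he : e ∈ S₂), (insert e S₁ ∆ τ') \ {e} = S₁ ∆ τ' := by
      intro he
      have he1 : e ∉ S₁ := fun h => Set.disjoint_left.1 hd h he
      rw [insert_symmDiff_of_notMem heτ, insert_sdiff_singleton_of_notMem]
      exact fun h => he1 ((mem_symmDiff_iff_of_notMem heτ _).1 h)
    constructor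
    · rintro ⟨he, hA, hC⟩; rw [aux he] at hA; exact ⟨he, hA, hC⟩
    · rintro ⟨he, hA, hC⟩; refine ⟨he, ?_, hC⟩; rw [aux he]; exact hA
  calc _ = _ := step0
    _ ≤ _ := step1
    _ = _ := step2
    _ ≤ _ := step3
    _ = _ := step4

/-- **THE DIGIT-2 CONE STEP.**  If every member of the up-set `𝒰` contains `e` and `e ∉ τ'`, then `2·N_{τ'}(𝒰ᵉ,𝒱ᵉ,𝒲ᵉ) ≤ 3·N_{insert e τ'}(𝒰,𝒱,𝒲)`
(the lane's Theorem C, `c₂ ≥ 2c₃` on the empty-bottom face, in the three-partition language). [this work] -/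
theorem two_mul_threePartNT_lift_le_three_mul (heτ : e ∉ τ') (h𝒰 : IsUpperSet 𝒰) (h𝒱 : IsUpperSet 𝒱) (h𝒲 : IsUpperSet 𝒲)
    (h𝒰e : ∀ T ∈ 𝒰, e ∈ T) :
    2 * threePartNT τ' ({R : Set ι | insert e R ∈ 𝒰}) ({R : Set ι | insert e R ∈ 𝒱}) ({R : Set ι | insert e R ∈ 𝒲})
      ≤ 3 * threePartNT (insert e τ') 𝒰 𝒱 𝒲 := by
  have htop := topT_insert_eq_two_mul τ' e (𝒱 := 𝒱) (𝒲 := 𝒲) heτ h𝒰e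
  have htop' := topT_lift_eq_three_mul τ' e (𝒰 := 𝒰) (𝒱 := 𝒱) (𝒲 := 𝒲) heτ
  have hd1 := deeT_one_insert_eq τ' e (𝒱 := 𝒱) (𝒲 := 𝒲) heτ h𝒰e
  have hd1' := deeT_one_lift_eq_three_mul τ' e (𝒰 := 𝒰) (𝒱 := 𝒱) (𝒲 := 𝒲) heτ
  have hd1b : tri (fun S₁ S₂ S₃ => e ∈ S₂ ∧ (S₁ ∆ τ' ∈ {R : Set ι | insert e R ∈ 𝒰} ∧ S₃ ∆ τ' ∈ 𝒱 ∩ 𝒲))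
      ≤ tri (fun S₁ S₂ S₃ => e ∈ S₂ ∧ (S₁ ∆ τ' ∈ {R : Set ι | insert e R ∈ 𝒰} ∧ S₃ ∆ τ' ∈ {R : Set ι | insert e R ∈ 𝒱} ∩ {R : Set ι | insert e R ∈ 𝒲})) := by
    refine tri_mono fun S₁ S₂ _ h => ⟨h.1, h.2.1, ?_⟩
    rw [← liftAt_inter]; exact mem_liftAt_of_mem e (h𝒱.inter h𝒲) h.2.2
  have hd2 := deeT_two_insert_eq τ' e (𝒱 := 𝒱) (𝒲 := 𝒲) heτ h𝒰e
  have hd2' := deeT_two_lift_eq_three_mul τ' e (𝒰 := 𝒰) (𝒱 := 𝒱) (𝒲 := 𝒲) heτ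
  have hg2 := deeT_two_add_gain_le τ' e (𝒰 := 𝒰) (𝒲 := 𝒲) h𝒱
  have hd3 := deeT_two_insert_eq τ' e (𝒱 := 𝒲) (𝒲 := 𝒱) heτ h𝒰e
  have hd3' := deeT_two_lift_eq_three_mul τ' e (𝒰 := 𝒰) (𝒱 := 𝒲) (𝒲 := 𝒱) heτ
  have hg3 := deeT_two_add_gain_le τ' e (𝒰 := 𝒰) (𝒲 := 𝒱) h𝒲
  have ht := teeT_insert_eq τ' e (𝒱 := 𝒱) (𝒲 := 𝒲) heτ h𝒰e
  have ht' := teeT_lift_eq_three_mul τ' e (𝒰 := 𝒰) (𝒱 := 𝒱) (𝒲 := 𝒲) heτ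
  -- the two pieces of the lifted tee that the original does not have
  have hX := incrT_two_le τ' e (𝒱 := 𝒱) heτ h𝒰 h𝒲
  have hY := incrT_three_le' τ' e (𝒲 := 𝒲) heτ h𝒰 h𝒱
  have hsplitB : tri (fun S₁ S₂ S₃ => e ∈ S₂ ∧ (S₁ ∆ τ' ∈ {R : Set ι | insert e R ∈ 𝒰} ∧ S₂ ∆ τ' ∈ 𝒱 ∧ S₃ ∆ τ' ∈ {R : Set ι | insert e R ∈ 𝒲}))
      ≤ tri (fun S₁ S₂ S₃ => e ∈ S₂ ∧ (S₁ ∆ τ' ∈ {R : Set ι | insert e R ∈ 𝒰} ∧ (S₂ ∆ τ') \ {e} ∈ 𝒱 ∧ S₃ ∆ τ' ∈ {R : Set ι | insert e R ∈ 𝒲}))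
        + tri (fun S₁ S₂ S₃ => e ∈ S₂ ∧ (S₁ ∆ τ' ∈ {R : Set ι | insert e R ∈ 𝒰} ∧ ((S₂ ∆ τ') \ {e} ∈ {R : Set ι | insert e R ∈ 𝒱} ∧ (S₂ ∆ τ') \ {e} ∉ 𝒱) ∧ S₃ ∆ τ' ∈ {R : Set ι | insert e R ∈ 𝒲})) := by
    refine tri_le_add₂ fun S₁ S₂ S₃ h => ?_
    obtain ⟨he, h1, h2, h3⟩ := h
    by_cases hV : (S₂ ∆ τ') \ {e} ∈ 𝒱
    · exact Or.inl ⟨he, h1, hV, h3⟩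
    · refine Or.inr ⟨he, h1, ⟨?_, hV⟩, h3⟩
      rw [diff_mem_liftAt_iff, mem_liftAt_iff_of_mem 𝒱 ((mem_symmDiff_iff_of_notMem heτ _).2 he)]; exact h2
  have hsplitC : tri (fun S₁ S₂ S₃ => e ∈ S₂ ∧ (S₁ ∆ τ' ∈ {R : Set ι | insert e R ∈ 𝒰} ∧ S₂ ∆ τ' ∈ 𝒱 ∧ S₃ ∆ τ' ∈ {R : Set ι | insert e R ∈ 𝒲}))
      ≤ tri (fun S₁ S₂ S₃ => e ∈ S₂ ∧ (S₁ ∆ τ' ∈ {R : Set ι | insert e R ∈ 𝒰} ∧ S₂ ∆ τ' ∈ 𝒱 ∧ S₃ ∆ τ' ∈ 𝒲))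
        + tri (fun S₁ S₂ S₃ => e ∈ S₂ ∧ (S₁ ∆ τ' ∈ {R : Set ι | insert e R ∈ 𝒰} ∧ S₂ ∆ τ' ∈ 𝒱 ∧ (S₃ ∆ τ' ∈ {R : Set ι | insert e R ∈ 𝒲} ∧ S₃ ∆ τ' ∉ 𝒲))) := by
    refine tri_le_add₂ fun S₁ S₂ S₃ h => ?_
    obtain ⟨he, h1, h2, h3⟩ := h
    by_cases hW : S₃ ∆ τ' ∈ 𝒲
    · exact Or.inl ⟨he, h1, h2, hW⟩
    · exact Or.inr ⟨he, h1, h2, h3, hW⟩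
  unfold threePartNT
  rw [htop, htop', hd1, hd1', hd2, hd2', hd3, hd3', ht, ht']
  push_cast
  omega

end DigitTwo

end Summit.CriticalPhenomena.PercolationContinuityZ3.Theorems.ThreePartition
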